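import Mathlib.Topology.Homotopy.Equiv
import Literature.Geometry.Riemannian.WeylEnergy
import Literature.Geometry.Riemannian.GurskyEinsteinGap
import HarnessLib

/-!
# The Gursky–LeBrun Weyl gap for positive Einstein 4-manifolds, on homotopy 4-spheres (named fact)

Source read, verbatim (M. J. Gursky, C. LeBrun, *On Einstein manifolds of positive sectional
curvature*, Ann. Global Anal. Geom. 17 (1999) 315–328 = arXiv:math/9807055, §2 and §3, p. 8 of the
arXiv version):

* (gb), (sig): "the 4-dimensional Chern-Gauss-Bonnet
  `χ(M) = (1/8π²) ∫_M [|W₊|² + |W₋|² + s²/24 - |r∘|²/2] dμ` and Hirzebruch signature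
  `τ(M) = (1/12π²) ∫_M [|W₊|² - |W₋|²] dμ` formulæ. Here the curvatures, norms `|·|`, and volume
  form `dμ` are, of course, those of any given Riemannian metric `g` on `M`." (`W^±` the self-dual
  and anti-self-dual Weyl curvatures of the ORIENTED Riemannian 4-manifold, `r∘` the trace-free
  Ricci tensor, `s` the scalar curvature; Besse 1987, 6.31 and 6.34.)
* "**Theorem 1.** Let `(M,g)` be a compact oriented Einstein 4-manifold with `s > 0` and
  `W⁺ ≢ 0`. Then `∫_M |W⁺_g|²_g dμ_g ≥ ∫_M (s_g²/24) dμ_g`, with equality iff `∇W⁺ ≡ 0`."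
  (originally Gursky 1998, Ann. of Math. 148).
* "Reading this in the mirror, we have: **Corollary 1.** Let `(M,g)` be an oriented compact
  Einstein 4-manifold with `s > 0` and `W⁻ ≢ 0`. Then (i) `∫_M |W⁻_g|² dμ_g ≥ ∫ (s_g²/24) dμ_g`,
  and (ii) `((2χ - 3τ)/3)(M) ≥ (1/4π²) ∫_M (s_g²/24) dμ_g`. Moreover, both these inequalities are
  strict unless `∇W⁻ ≡ 0`. *Proof.* Reversing the orientation of `M` interchanges `W⁺` and `W⁻`.
  Applying this observation to Theorem 1 immediately yields (i). But this and the
  Gauss-Bonnet-type formulæ (gb)–(sig) then tell us that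
  `(2χ - 3τ)(M) = (1/4π²) ∫_M [2|W⁻_g|² + s²/24] dμ_g ≥ (3/4π²) ∫_M (s_g²/24) dμ_g`."

## Status: a COROLLARY of the tree's Gursky–LeBrun development (read this first)

The Gursky–LeBrun Weyl gap on homotopy 4-spheres is ALREADY in the tree, in
`Literature/Geometry/Riemannian/GurskyEinsteinGap*.lean` (found after this file first landed;
librarian sweep g38): the named facts `GurskyLeBrun1999_thm1_homotopySphere` (Thm. 1, read
frame-wise along an orientation), `GurskyLeBrun1999_cor1_homotopySphere` (Cor. 1) and
`signatureFormula_weyl_homotopySphere_four` (`GurskyEinsteinGapSplit.lean`); the named fact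
`gursky_einstein_homotopySphere_four` (`GurskyEinsteinGap.lean`: an Einstein metric `Ric = λ g`,
`λ > 0`, on a closed smooth `M ≃ₕ S⁴` has `W ≡ 0` — all orthonormal-frame Weyl components vanish
— OR `vol(M, g) ≤ 8π²/λ²`), PROVED from those three children
(`gursky_einstein_homotopySphere_four_holds_of_three`, `GurskyEinsteinGapSplitThree.lean`, using
the tree's proved Chern–Gauss–Bonnet theorem `chernGaussBonnet_four_holds` and
`χ(M ≃ₕ S⁴) = 2`, `finRelHomology_of_homotopyEquiv_sphere_four`); and the upgrade of the first
alternative to constant sectional curvature `λ/3` (`EinsteinWeylZero.lean`,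
`gursky_einstein_homotopySphere_four.hasConstantSectionalCurvature_or_volume_le`) and, with a
sphere-recognition fact, to `M ≅ S⁴` (`….diffeomorph_sphere_or_volume_le`). Contrary to the
request that prompted this file (cite item wi-39227), the Weyl tensor, `|W|²`, the Euler
characteristic (`relEuler`) and Chern–Gauss–Bonnet ARE tree notions; only `W^±` as tensors,
the Hodge star and the signature `τ` are absent (the children above read `|W^±|²` frame-wise).

Accordingly the statement below, `gurskyLeBrun_weyl_eq_zero_homotopyFourSphere`, is the case
`λ = 3` of `gursky_einstein_homotopySphere_four` in the binder shape of its consumer (a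
`Bundle.ContMDiffRiemannianMetric` `h`, `Ric_h = 3h`, the strict volume bound
`Vol(M, h) > 8π²/9 = 8π²/3²` excluding the second alternative, conclusion `|W_h|²(x) = 0`), and it
is PROVED from that fact here: `gurskyLeBrun_weyl_eq_zero_homotopyFourSphere_of_gursky`. Its
trust base is therefore exactly that of `gursky_einstein_homotopySphere_four` (the three children
above); it adds no independent named fact. Consumers: route `SmoothPoincare4/RicciFat`, crux
`RecognitionBeyondWeylGap` (stmt-SmoothPoincare4-18049), stub `stub_einsteinWeylGap` of its line
`birth` — which may equally use
`gursky_einstein_homotopySphere_four.diffeomorph_sphere_or_volume_le` directly.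

## The statement and its derivation from the printed results

* `gurskyLeBrun_weyl_eq_zero_homotopyFourSphere` — for every compact (closed) smooth 4-manifold
  `M` homotopy equivalent to `S⁴` and every `C^∞` Riemannian metric `h` on `M` (with its
  Levi-Civita connection) which is EINSTEIN with `Ric_h = 3h` and has total volume
  `Vol(M, h) > 8π²/9`, the Weyl tensor of `h` vanishes identically: `|W_h|²(x) = 0` for all `x`.

Derivation (bookkeeping only; every step is classical, and it is the `λ = 3` instance of the
module docstring of `GurskyEinsteinGap.lean`):
(1) `M ≃ₕ S⁴` is simply connected, hence orientable; fix an orientation. `M` is compact, `h` is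
Einstein with `s = tr_h Ric_h = 4 · 3 = 12 > 0`, `r∘ = 0`, `s²/24 = 6`.
(2) `χ(M) = χ(S⁴) = 2` and `τ(M) = 0` (`H²(M; ℝ) = H²(S⁴; ℝ) = 0`), so (gb) and (sig) read
`2 = (1/8π²) ∫ [|W₊|² + |W₋|² + 6] dμ` and `0 = ∫ [|W₊|² - |W₋|²] dμ`, i.e.
`∫ |W₊|² dμ = ∫ |W₋|² dμ = 8π² - 3 Vol(M, h)` (GL's own computation:
`(2χ ± 3τ)(M) = (1/4π²) ∫ [2|W^±|² + s²/24] dμ` for Einstein `g`).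
(3) If `W⁺ ≢ 0`, Theorem 1 gives `8π² - 3 Vol ≥ ∫ s²/24 dμ = 6 Vol`, i.e. `Vol ≤ 8π²/9`; if
`W⁻ ≢ 0`, Corollary 1 (i) gives the same. Hence `Vol > 8π²/9` forces `W⁺ ≡ 0` AND `W⁻ ≡ 0`,
i.e. `W = W⁺ + W⁻ ≡ 0`, which is `|W|²(x) = 0` at every point for the `(0,4)`-norm of
`WeylEnergy.lean` (any norm: `W_x = 0`). The equality cases `∇W^± ≡ 0` of Theorem 1 / Cor. 1 are
never needed (strict `Vol > 8π²/9`). Nothing is claimed about metrics with `Ric ≥ 3` that are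
not Einstein, about `Vol = 8π²/9`, or about the diffeomorphism type of `M`.

## Cone

Imports `WeylEnergy.lean` (definitions) and `GurskyEinsteinGap.lean` (the named fact it is a
corollary of, with `EinsteinWeylZero.lean` and `PICSphereFacts.lean` in its cone). A `def … : Prop`
(kept so that consumers can name the statement) plus its proof from
`gursky_einstein_homotopySphere_four`; no `_holds` of its own beyond that reduction.

## References

* M. J. Gursky, C. LeBrun, *On Einstein manifolds of positive sectional curvature*, Ann. Global
  Anal. Geom. 17 (1999) 315–328, arXiv:math/9807055: (gb), (sig), Thm. 1, Cor. 1.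
  [GurskyLeBrun1999]
* M. J. Gursky, *The Weyl functional, de Rham cohomology, and Kähler–Einstein metrics*, Ann. of
  Math. 148 (1998) 315–337 (the original gap theorem). [Gursky1998]
* A. L. Besse, *Einstein Manifolds* (1987), 6.31 (Chern–Gauss–Bonnet in dimension 4), 6.34
  (Hirzebruch signature formula), 6.35. [Besse1987]
* M. J. Gursky, *Four-manifolds with `δW⁺ = 0` and Einstein constants of the sphere*, Math. Ann.
  318 (2000) 417–431, Thm. 1 (the tree's `gursky_einstein_homotopySphere_four`). [Gursky2000]
-/

noncomputable section

open scoped Manifold ContDiff ENNReal ContinuousMap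

namespace Literature.Geometry.Riemannian

open Literature.Geometry.Lorentzian (PseudoRiemannianMetric riemannianMeasure)

/-- **Gursky–LeBrun Weyl gap, consequence on homotopy 4-spheres: an Einstein metric `Ric = 3h`
with `Vol > 8π²/9` on a closed smooth `M ≃ₕ S⁴` has `W ≡ 0`** — the case `λ = 3` of the tree's
named fact `gursky_einstein_homotopySphere_four` (`GurskyEinsteinGap.lean`), from which it is
PROVED below (`gurskyLeBrun_weyl_eq_zero_homotopyFourSphere_of_gursky`); kept as a `def` in the
binder shape of its consumer. Printed (Gursky–LeBrun 1999,
Thm. 1): "Let `(M,g)` be a compact oriented Einstein 4-manifold with `s > 0` and `W⁺ ≢ 0`. Then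
`∫_M |W⁺_g|² dμ_g ≥ ∫_M (s_g²/24) dμ_g`, with equality iff `∇W⁺ ≡ 0`"; Cor. 1 (i): the same for
`W⁻` (reverse the orientation); with the Chern–Gauss–Bonnet and signature formulæ (gb), (sig)
(Besse 1987, 6.31, 6.34), for Einstein `g`: `(2χ ± 3τ)(M) = (1/4π²) ∫_M [2|W^±|² + s²/24] dμ`.
CONSEQUENCE vendored here (module docstring, steps (1)–(3)): for every compact, Hausdorff, second
countable `C^∞` 4-manifold `M` modelled on `ℝ⁴` (closed: boundaryless charts) that is homotopy
equivalent to the unit sphere `S⁴ ⊂ ℝ⁵` — so `M` is simply connected, orientable, `χ(M) = 2`,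
`τ(M) = 0` — and every `C^∞` Riemannian metric `h` on `TM` with its Levi-Civita connection
(`[(ofRiemannian h).HasLeviCivita]`) such that `Ric_h = 3h` (Einstein, `s = 12 > 0`) and
`Vol(M, h) = riemannianMeasure h univ > 8π²/9`: since `∫|W^±|² dμ = 8π² - 3 Vol` by (gb), (sig),
`W^± ≢ 0` would give `8π² - 3 Vol ≥ 6 Vol`, i.e. `Vol ≤ 8π²/9`; so `W⁺ ≡ 0` and `W⁻ ≡ 0`, i.e.
`W_h ≡ 0`: the pointwise squared `(0,4)`-norm `|W_h|²(x)` (`weylNormSq`, `WeylEnergy.lean`)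
vanishes at every `x`. Nothing beyond Thm. 1 + Cor. 1 (i) + (gb), (sig) + `χ(S⁴) = 2`, `τ = 0` is
asserted (no equality case, no diffeomorphism conclusion).
[cite: GurskyLeBrun1999, Thm. 1 and Cor. 1 (i), with (gb) and (sig)]
[cite: Besse1987, 6.31 and 6.34] [cite: Gursky2000, Thm. 1] -/
def gurskyLeBrun_weyl_eq_zero_homotopyFourSphere : Prop :=
  ∀ (M : Type) [TopologicalSpace M] [T2Space M] [SecondCountableTopology M]
    [ChartedSpace (EuclideanSpace ℝ (Fin 4)) M] [IsManifold (𝓡 4) ∞ M] [CompactSpace M]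
    [MeasurableSpace M] [BorelSpace M], M ≃ₕ Metric.sphere (0 : EuclideanSpace ℝ (Fin 5)) 1 →
    ∀ (h : Bundle.ContMDiffRiemannianMetric (𝓡 4) ∞ (EuclideanSpace ℝ (Fin 4))
        (TangentSpace (𝓡 4) : M → Type _))
      [(PseudoRiemannianMetric.ofRiemannian h).HasLeviCivita],
      (∀ (x : M) (v w : TangentSpace (𝓡 4) x),
          (PseudoRiemannianMetric.ofRiemannian h).ricci x v w = 3 * h.inner x v w) →
      ENNReal.ofReal (8 * Real.pi ^ 2 / 9) < riemannianMeasure h Set.univ →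
      ∀ x : M, (PseudoRiemannianMetric.ofRiemannian h).weylNormSq x = 0

/-- **Proof from the tree's fact `gursky_einstein_homotopySphere_four` (case `λ = 3`).** For
`h` as in the statement, `g = ofRiemannian h` is a Riemannian `PseudoRiemannianMetric` with
`Ric_g = 3 g`; `M` is `T₃` (compact Hausdorff); the fact gives either vanishing of all
orthonormal-frame Weyl components — whence `|W_g|²(x) = 0` (`weylNormSq_eq_zero`, after
reindexing frames along `finrank ℝ ℝ⁴ = 4`) — or `vol(M, g) ≤ 8π²/3²`, where the measure of
`g.toContMDiffRiemannianMetric _ = h` (by `rfl`) is the `riemannianMeasure h` of the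
hypothesis `Vol > 8π²/9`: contradiction. [cite: Gursky2000, Thm. 1]
[cite: GurskyLeBrun1999, Thm. 1 and Cor. 1 (i)] -/
theorem gurskyLeBrun_weyl_eq_zero_homotopyFourSphere_of_gursky
    (hG : gursky_einstein_homotopySphere_four) :
    gurskyLeBrun_weyl_eq_zero_homotopyFourSphere := by
  intro M _ _ _ _ _ _ _ _ e h _ hRic hVol x
  haveI : T3Space M := inferInstance
  have hg : (PseudoRiemannianMetric.ofRiemannian h).IsRiemannian :=
    PseudoRiemannianMetric.isRiemannian_ofRiemannian h
  rcases hG M e (PseudoRiemannianMetric.ofRiemannian h) hg 3 (by norm_num) hRic with hW | hvol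
  · refine (PseudoRiemannianMetric.ofRiemannian h).weylNormSq_eq_zero x fun f hf i j k l ↦ ?_
    have key : ∀ (m : ℕ) (_ : m = 4) (f : Fin m → TangentSpace (𝓡 4) x),
        (PseudoRiemannianMetric.ofRiemannian h).IsOrthonormalFrame x f →
          ∀ i j k l, (PseudoRiemannianMetric.ofRiemannian h).weylFrame x f i j k l = 0 := by
      intro m hm f hf
      subst hm
      exact hW x f hf
    exact key _ finrank_euclideanSpace_fin f hf i j k l
  · exfalso
    have hround : (PseudoRiemannianMetric.ofRiemannian h).toContMDiffRiemannianMetric hg = h :=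
      rfl
    have h9 : ENNReal.ofReal (8 * Real.pi ^ 2 / (3 : ℝ) ^ 2) =
        ENNReal.ofReal (8 * Real.pi ^ 2 / 9) := by norm_num
    rw [hround, h9] at hvol
    exact absurd (hVol.trans_le hvol) (lt_irrefl _)

/-- The fact with its binders instantiated, in the shape the stub `stub_einsteinWeylGap` of crux
`RecognitionBeyondWeylGap` (route SmoothPoincare4/RicciFat) meets it: from the existential
hypothesis "`M ≃ₕ S⁴` carries an Einstein metric `Ric = 3h` with `Vol > 8π²/9`" one gets such a
metric WITH `|W_h|² ≡ 0`. [cite: GurskyLeBrun1999, Thm. 1 and Cor. 1 (i)] -/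
theorem gurskyLeBrun_weyl_eq_zero_homotopyFourSphere.exists_weylNormSq_eq_zero
    (hGL : gurskyLeBrun_weyl_eq_zero_homotopyFourSphere)
    (M : Type) [TopologicalSpace M] [T2Space M] [SecondCountableTopology M]
    [ChartedSpace (EuclideanSpace ℝ (Fin 4)) M] [IsManifold (𝓡 4) ∞ M] [CompactSpace M]
    [MeasurableSpace M] [BorelSpace M] (e : M ≃ₕ Metric.sphere (0 : EuclideanSpace ℝ (Fin 5)) 1)
    (hex : ∃ h : Bundle.ContMDiffRiemannianMetric (𝓡 4) ∞ (EuclideanSpace ℝ (Fin 4))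
        (TangentSpace (𝓡 4) : M → Type _),
      ∃ _ : (PseudoRiemannianMetric.ofRiemannian h).HasLeviCivita,
        (∀ (x : M) (v w : TangentSpace (𝓡 4) x),
          (PseudoRiemannianMetric.ofRiemannian h).ricci x v w = 3 * h.inner x v w) ∧
        ENNReal.ofReal (8 * Real.pi ^ 2 / 9) < riemannianMeasure h Set.univ) :
    ∃ h : Bundle.ContMDiffRiemannianMetric (𝓡 4) ∞ (EuclideanSpace ℝ (Fin 4))
        (TangentSpace (𝓡 4) : M → Type _),
      ∃ _ : (PseudoRiemannianMetric.ofRiemannian h).HasLeviCivita,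
        (∀ (x : M) (v w : TangentSpace (𝓡 4) x),
          (PseudoRiemannianMetric.ofRiemannian h).ricci x v w = 3 * h.inner x v w) ∧
        ENNReal.ofReal (8 * Real.pi ^ 2 / 9) < riemannianMeasure h Set.univ ∧
        ∀ x : M, (PseudoRiemannianMetric.ofRiemannian h).weylNormSq x = 0 := by
  obtain ⟨h, hLC, hRic, hVol⟩ := hex
  exact ⟨h, hLC, hRic, hVol, hGL M e h hRic hVol⟩

end Literature.Geometry.Riemannian

end
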